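import Mathlib

/-!
# `ZoomMonotone` (item stmt-CriticalPhenomena-14454), negative lemma, part 1/2: the axis-facts package
# and a witness whose doubling ratio never settles (refuter, crux-attack 2026-08-16)

`AxisFacts g` packages everything the tree knows about the critical axis two-point function
`g(k) = ⟨σ₀σ_{k e₀}⟩_{β_c}` on `ℤ³` (`g 0 = 1`, `0 < g ≤ 1`, nonincreasing, LOG-CONVEX, successive
ratios nondecreasing and `→ 1`, the window `c k⁻² ≤ g ≤ C k⁻¹`; part 2 checks the real `g` has them).
`EventuallyMonotoneDoubling g` is the shape of the cheapest instance (`n = 2`, `x = (0, 2e₀)`) of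
`MonotoneRG.ZoomMonotone`: eventual monotonicity of `k ↦ g(2k)/g(k)`.

Main result here: `axisFacts_not_sufficient : ∃ g, AxisFacts g ∧ ¬ EventuallyMonotoneDoubling g`, with
the explicit dyadic-block witness `gW = exp (−S)`, `S k = ∑_{j<k} lev ⌊log₂ j⌋`,
`lev (2t) = log 4 / 4ᵗ`, `lev (2t+1) = log 4 / (3·4ᵗ)`: its doubling ratio strictly increases at every
`k = 4ᵗ` and strictly decreases at every `k = 2·4ᵗ`. Mathlib only; sorry-free.
-/

noncomputable section

open Real Finset Filter Set
open scoped Topology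

namespace Summit.CriticalPhenomena.Ising3DConformalLimit.Theorems.ZoomMonotone.Negative

/-- The structural facts the tree knows about `g(k) = ⟨σ₀σ_{k e₀}⟩_{β_c}` on `ℤ³`: `criticalTwoPoint_zero'`,
Simon–Lieb positivity, `criticalTwoPoint_le_one'`, `criticalTwoPoint_axis_succ_le`,
`criticalTwoPoint_axis_sq_le` (log-convexity, ADC21 Prop. 5.3), `criticalTwoPoint_axis_ratio_mono`,
`criticalTwoPoint_axis_ratio_tendsto_one'`, `criticalTwoPoint_bounds_holds` (`d = 3`). [folklore] -/
structure AxisFacts (g : ℕ → ℝ) : Prop where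
  zero : g 0 = 1
  pos : ∀ k, 0 < g k
  le_one : ∀ k, g k ≤ 1
  anti : Antitone g
  logConvex : ∀ n, 1 ≤ n → g n ^ 2 ≤ g (n - 1) * g (n + 1)
  ratioMono : Monotone fun k => g (k + 2) / g (k + 1)
  ratioTendsto : Tendsto (fun k => g (k + 1) / g k) atTop (𝓝 1)
  lower : ∃ c : ℝ, 0 < c ∧ ∀ k : ℕ, 1 ≤ k → c / (k : ℝ) ^ 2 ≤ g k
  upper : ∃ C : ℝ, ∀ k : ℕ, 1 ≤ k → g k ≤ C / (k : ℝ)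

/-- Eventual monotonicity (either direction) of the doubling ratio `k ↦ g(2k)/g(k)`. [folklore] -/
def EventuallyMonotoneDoubling (g : ℕ → ℝ) : Prop :=
  ∃ m₀ : ℕ, MonotoneOn (fun m => g (2 * m) / g m) (Set.Ici m₀) ∨
    AntitoneOn (fun m => g (2 * m) / g m) (Set.Ici m₀)

/-! ## The witness -/

/-- Level values: `lev (2t) = log 4 / 4ᵗ`, `lev (2t+1) = log 4 / (3·4ᵗ)`. [folklore] -/
def lev (i : ℕ) : ℝ := Real.log 4 * (if i % 2 = 0 then 1 else 1 / 3) / 4 ^ (i / 2)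

/-- `S k = ∑_{j<k} lev ⌊log₂ j⌋` (with `⌊log₂ 0⌋ = 0`). [folklore] -/
def S (k : ℕ) : ℝ := ∑ j ∈ Finset.range k, lev (Nat.log 2 j)

/-- The witness `gW = exp (−S)`. [folklore] -/
def gW (k : ℕ) : ℝ := Real.exp (-S k)

/-- `0 < log 4`. [folklore] -/
theorem log_four_pos : 0 < Real.log 4 := Real.log_pos (by norm_num)

/-- `log 4 = 2 log 2`. [folklore] -/
theorem log_four_eq : Real.log 4 = 2 * Real.log 2 := by
  rw [show (4:ℝ) = 2 ^ 2 by norm_num, Real.log_pow]; norm_num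

/-- `0 < lev i`. [folklore] -/
theorem lev_pos (i : ℕ) : 0 < lev i := by
  unfold lev
  have h4 : (0:ℝ) < 4 ^ (i / 2) := by positivity
  split_ifs <;> positivity

/-- Even levels. [folklore] -/
theorem lev_even (t : ℕ) : lev (2 * t) = Real.log 4 / 4 ^ t := by
  unfold lev
  rw [if_pos (by omega), show 2 * t / 2 = t by omega, mul_one]

/-- Odd levels. [folklore] -/
theorem lev_odd (t : ℕ) : lev (2 * t + 1) = Real.log 4 / 3 / 4 ^ t := by
  unfold lev
  rw [if_neg (by omega), show (2 * t + 1) / 2 = t by omega]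
  ring

/-- `lev` is nonincreasing step by step. [folklore] -/
theorem lev_succ_le (i : ℕ) : lev (i + 1) ≤ lev i := by
  obtain ⟨t, rfl | rfl⟩ := Nat.even_or_odd' i
  · rw [lev_even, lev_odd]
    have h4 : (0:ℝ) < 4 ^ t := by positivity
    have hl := log_four_pos
    rw [div_le_div_iff_of_pos_right h4]
    linarith
  · rw [show 2 * t + 1 + 1 = 2 * (t + 1) by ring, lev_even, lev_odd, pow_succ]
    have h4 : (0:ℝ) < 4 ^ t := by positivity
    have hl := log_four_pos
    rw [div_le_div_iff₀ (by positivity) h4]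
    nlinarith

/-- `lev` is nonincreasing. [folklore] -/
theorem lev_antitone : Antitone lev := antitone_nat_of_succ_le lev_succ_le

/-- `lev i ≤ 2 log 4 / 2ⁱ`. [folklore] -/
theorem lev_le (i : ℕ) : lev i ≤ 2 * Real.log 4 / 2 ^ i := by
  have key : lev i ≤ Real.log 4 / 4 ^ (i / 2) := by
    unfold lev
    have h4 : (0:ℝ) < 4 ^ (i / 2) := by positivity
    rw [div_le_div_iff_of_pos_right h4]
    have hl := log_four_pos
    split_ifs <;> nlinarith
  refine key.trans ?_
  rw [div_le_div_iff₀ (by positivity) (by positivity)]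
  have h : (2:ℝ) ^ i ≤ 2 * 4 ^ (i / 2) := by
    have h1 : (4:ℝ) ^ (i / 2) = 2 ^ (2 * (i / 2)) := by
      rw [pow_mul]; norm_num
    rw [h1, ← pow_succ']
    exact pow_le_pow_right₀ (by norm_num) (by omega)
  nlinarith [log_four_pos]

/-- `lev → 0`. [folklore] -/
theorem tendsto_lev : Tendsto lev atTop (𝓝 0) := by
  refine squeeze_zero (fun i => (lev_pos i).le) lev_le ?_
  have h : Tendsto (fun i : ℕ => 2 * Real.log 4 * (1 / 2 : ℝ) ^ i) atTop (𝓝 (2 * Real.log 4 * 0)) :=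
    (tendsto_pow_atTop_nhds_zero_of_lt_one (by norm_num) (by norm_num)).const_mul _
  rw [mul_zero] at h
  refine h.congr fun i => ?_
  rw [one_div, inv_pow, div_eq_mul_inv]

/-- `lev ⌊log₂ k⌋ → 0`. [folklore] -/
theorem tendsto_lev_log : Tendsto (fun k : ℕ => lev (Nat.log 2 k)) atTop (𝓝 0) := by
  rw [Metric.tendsto_atTop]
  intro ε hε
  obtain ⟨i₀, hi₀⟩ := (Metric.tendsto_atTop.1 tendsto_lev) ε hε
  exact ⟨2 ^ i₀, fun k hk => hi₀ (Nat.log 2 k) (Nat.le_log_of_pow_le (by norm_num) hk)⟩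

/-- `S 0 = 0`. [folklore] -/
theorem S_zero : S 0 = 0 := by simp [S]

/-- `S (k+1) = S k + lev ⌊log₂ k⌋`. [folklore] -/
theorem S_succ (k : ℕ) : S (k + 1) = S k + lev (Nat.log 2 k) := by
  simp [S, Finset.sum_range_succ]

/-- `0 ≤ S k`. [folklore] -/
theorem S_nonneg (k : ℕ) : 0 ≤ S k := Finset.sum_nonneg fun _ _ => (lev_pos _).le

/-- `S` is nondecreasing. [folklore] -/
theorem S_mono : Monotone S := monotone_nat_of_le_succ fun k => by
  rw [S_succ]; exact le_add_of_nonneg_right (lev_pos _).le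

/-- Block decomposition: `S (2^(I+1)) = S (2^I) + 2^I · lev I`. [folklore] -/
theorem S_pow_succ (I : ℕ) : S (2 ^ (I + 1)) = S (2 ^ I) + 2 ^ I * lev I := by
  have hle : 2 ^ I ≤ 2 ^ (I + 1) := Nat.pow_le_pow_right (by norm_num) (by omega)
  have h : S (2 ^ (I + 1)) = S (2 ^ I) + ∑ j ∈ Finset.Ico (2 ^ I) (2 ^ (I + 1)), lev (Nat.log 2 j) := by
    unfold S
    rw [Finset.range_eq_Ico, Finset.range_eq_Ico, Finset.sum_Ico_consecutive _ (Nat.zero_le _) hle]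
  rw [h]
  congr 1
  have hcard : 2 ^ (I + 1) - 2 ^ I = 2 ^ I := by rw [pow_succ]; omega
  have : ∀ x ∈ Finset.Ico (2 ^ I) (2 ^ (I + 1)), lev (Nat.log 2 x) = lev I := by
    intro x hx
    rw [Finset.mem_Ico] at hx
    congr 1
    exact Nat.log_eq_of_pow_le_of_lt_pow hx.1 hx.2
  rw [Finset.sum_congr rfl this, Finset.sum_const, Nat.card_Ico, hcard, nsmul_eq_mul]
  push_cast
  ring

/-- Even blocks weigh `log 4`. [folklore] -/
theorem block_even (t : ℕ) : (2:ℝ) ^ (2 * t) * lev (2 * t) = Real.log 4 := by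
  have h4 : (4:ℝ) ^ t ≠ 0 := by positivity
  rw [lev_even, pow_mul, show (2:ℝ) ^ 2 = 4 by norm_num, mul_div_assoc', mul_comm, ← mul_div_assoc',
    div_self h4, mul_one]

/-- Odd blocks weigh `(2/3) log 4`. [folklore] -/
theorem block_odd (t : ℕ) : (2:ℝ) ^ (2 * t + 1) * lev (2 * t + 1) = 2 * Real.log 4 / 3 := by
  have h4 : (0:ℝ) < 4 ^ t := by positivity
  rw [lev_odd, pow_succ, pow_mul, show (2:ℝ) ^ 2 = 4 by norm_num, div_div, mul_div_assoc',
    div_eq_iff (by positivity)]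
  ring

/-- Every block weighs at most `log 4`. [folklore] -/
theorem block_le (I : ℕ) : 2 ^ I * lev I ≤ Real.log 4 := by
  have hl := log_four_pos
  obtain ⟨t, rfl | rfl⟩ := Nat.even_or_odd' I
  · rw [block_even]
  · rw [block_odd]; linarith

/-- Every block weighs at least `log 2`. [folklore] -/
theorem block_ge (I : ℕ) : Real.log 2 ≤ 2 ^ I * lev I := by
  have hl2 : 0 < Real.log 2 := Real.log_pos (by norm_num)
  obtain ⟨t, rfl | rfl⟩ := Nat.even_or_odd' I
  · rw [block_even, log_four_eq]; linarith
  · rw [block_odd, log_four_eq]; linarith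

/-- `S 1 = log 4`. [folklore] -/
theorem S_one : S 1 = Real.log 4 := by
  rw [show (1:ℕ) = 0 + 1 from rfl, S_succ, S_zero, Nat.log_zero_right]
  simp [lev]

/-- `S (2^I) ≤ (I+1) log 4`. [folklore] -/
theorem S_pow_le (I : ℕ) : S (2 ^ I) ≤ (I + 1) * Real.log 4 := by
  induction I with
  | zero => simp [S_one]
  | succ I ih => rw [S_pow_succ]; push_cast; nlinarith [block_le I]

/-- `(I+2) log 2 ≤ S (2^I)`. [folklore] -/
theorem S_pow_ge (I : ℕ) : (I + 2) * Real.log 2 ≤ S (2 ^ I) := by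
  induction I with
  | zero => simp [S_one, log_four_eq]
  | succ I ih => rw [S_pow_succ]; push_cast; nlinarith [block_ge I]

/-- `0 < gW`. [folklore] -/
theorem gW_pos (k : ℕ) : 0 < gW k := Real.exp_pos _

/-- `n ≤ 4ⁿ`. [folklore] -/
theorem le_four_pow (n : ℕ) : n ≤ 4 ^ n := by
  induction n with
  | zero => simp
  | succ n ih =>
    have h1 : 1 ≤ 4 ^ n := Nat.one_le_pow _ _ (by norm_num)
    calc n + 1 ≤ 4 ^ n + 1 := by omega
      _ ≤ 4 ^ (n + 1) := by rw [pow_succ]; omega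

/-- Upper window: `gW k ≤ (1/2)/k` for `k ≥ 1`. [folklore] -/
theorem gW_upper (k : ℕ) (hk : 1 ≤ k) : gW k ≤ (1 / 2) / (k : ℝ) := by
  have hk0 : k ≠ 0 := by omega
  set I := Nat.log 2 k with hI
  have hlt : k < 2 ^ (I + 1) := Nat.lt_pow_succ_log_self (by norm_num) k
  have h1 : gW k ≤ Real.exp (-(((I:ℝ) + 2) * Real.log 2)) := by
    unfold gW
    rw [Real.exp_le_exp, neg_le_neg_iff]
    exact (S_pow_ge I).trans (S_mono (Nat.pow_log_le_self 2 hk0))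
  have h2 : Real.exp (-(((I:ℝ) + 2) * Real.log 2)) = ((2:ℝ) ^ (I + 2))⁻¹ := by
    rw [show ((I:ℝ) + 2) = ((I + 2 : ℕ) : ℝ) by push_cast; ring, Real.exp_neg, ← Real.log_pow,
      Real.exp_log (by positivity)]
  rw [h2] at h1
  have hkR : (k : ℝ) < 2 ^ (I + 1) := by exact_mod_cast hlt
  rw [div_div, one_div]
  refine h1.trans (inv_anti₀ (by positivity) ?_)
  rw [pow_succ]
  linarith

/-- Lower window: `(1/16)/k² ≤ gW k` for `k ≥ 1`. [folklore] -/
theorem gW_lower (k : ℕ) (hk : 1 ≤ k) : (1 / 16) / (k : ℝ) ^ 2 ≤ gW k := by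
  have hk0 : k ≠ 0 := by omega
  set I := Nat.log 2 k with hI
  have hle : 2 ^ I ≤ k := Nat.pow_log_le_self 2 hk0
  have hlt : k < 2 ^ (I + 1) := Nat.lt_pow_succ_log_self (by norm_num) k
  have h1 : Real.exp (-(((I:ℝ) + 2) * Real.log 4)) ≤ gW k := by
    unfold gW
    rw [Real.exp_le_exp, neg_le_neg_iff]
    refine (S_mono hlt.le).trans ?_
    have := S_pow_le (I + 1)
    push_cast at this
    linarith
  have h2 : Real.exp (-(((I:ℝ) + 2) * Real.log 4)) = ((4:ℝ) ^ (I + 2))⁻¹ := by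
    rw [show ((I:ℝ) + 2) = ((I + 2 : ℕ) : ℝ) by push_cast; ring, Real.exp_neg, ← Real.log_pow,
      Real.exp_log (by positivity)]
  rw [h2] at h1
  refine le_trans ?_ h1
  have hkR : (2:ℝ) ^ I ≤ k := by exact_mod_cast hle
  have h4 : (4:ℝ) ^ I = (2 ^ I) ^ 2 := by rw [← pow_mul, mul_comm, pow_mul]; norm_num
  have hsq : ((2:ℝ) ^ I) ^ 2 ≤ (k : ℝ) ^ 2 := pow_le_pow_left₀ (by positivity) hkR 2
  have hkpos : (0 : ℝ) < k := by exact_mod_cast Nat.pos_of_ne_zero hk0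
  rw [div_div, one_div]
  refine inv_anti₀ (by positivity) ?_
  rw [pow_add, h4]
  nlinarith

/-- **The witness has every property in `AxisFacts`.** [folklore] -/
theorem axisFacts_gW : AxisFacts gW where
  zero := by simp [gW, S_zero]
  pos := gW_pos
  le_one k := by
    unfold gW
    rw [Real.exp_le_one_iff, neg_nonpos]
    exact S_nonneg k
  anti := fun a b hab => by
    unfold gW
    exact Real.exp_le_exp.2 (neg_le_neg (S_mono hab))
  logConvex n hn := by
    unfold gW
    rw [← Real.exp_nat_mul, ← Real.exp_add, Real.exp_le_exp]
    obtain ⟨m, rfl⟩ : ∃ m, n = m + 1 := ⟨n - 1, by omega⟩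
    rw [show m + 1 - 1 = m by omega, show m + 1 + 1 = m + 2 by omega,
      show S (m + 2) = S (m + 1) + lev (Nat.log 2 (m + 1)) from S_succ (m + 1), S_succ m]
    push_cast
    have : lev (Nat.log 2 (m + 1)) ≤ lev (Nat.log 2 m) :=
      lev_antitone (Nat.log_mono_right (Nat.le_succ m))
    linarith
  ratioMono := by
    have h : ∀ k, gW (k + 2) / gW (k + 1) = Real.exp (-lev (Nat.log 2 (k + 1))) := by
      intro k
      unfold gW
      rw [show k + 2 = k + 1 + 1 by omega, S_succ (k + 1), ← Real.exp_sub]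
      congr 1; ring
    simp_rw [h]
    intro a b hab
    exact Real.exp_le_exp.2 (neg_le_neg (lev_antitone (Nat.log_mono_right (by omega))))
  ratioTendsto := by
    have h : ∀ k, gW (k + 1) / gW k = Real.exp (-lev (Nat.log 2 k)) := by
      intro k
      unfold gW
      rw [S_succ k, ← Real.exp_sub]
      congr 1; ring
    simp_rw [h]
    have := (tendsto_lev_log.neg).rexp
    simpa using this
  lower := ⟨1 / 16, by norm_num, gW_lower⟩
  upper := ⟨1 / 2, gW_upper⟩

/-- The doubling ratio steps by the factor `exp (−(2·lev(I+1) − lev I))`, `I = ⌊log₂ k⌋`. [folklore] -/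
theorem doubling_succ (k : ℕ) (hk : 1 ≤ k) :
    gW (2 * (k + 1)) / gW (k + 1) =
      gW (2 * k) / gW k * Real.exp (-(2 * lev (Nat.log 2 k + 1) - lev (Nat.log 2 k))) := by
  have hk0 : k ≠ 0 := by omega
  set I := Nat.log 2 k with hI
  have hle : 2 ^ I ≤ k := Nat.pow_log_le_self 2 hk0
  have hlt : k < 2 ^ (I + 1) := Nat.lt_pow_succ_log_self (by norm_num) k
  have hlog1 : Nat.log 2 (2 * k) = I + 1 := by
    apply Nat.log_eq_of_pow_le_of_lt_pow <;> rw [pow_succ] <;> omega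
  have hlog2 : Nat.log 2 (2 * k + 1) = I + 1 := by
    apply Nat.log_eq_of_pow_le_of_lt_pow
    · rw [pow_succ]; omega
    · rw [pow_succ, pow_succ]; omega
  unfold gW
  rw [show 2 * (k + 1) = 2 * k + 1 + 1 by ring, S_succ (2 * k + 1), S_succ (2 * k), S_succ k,
    hlog1, hlog2, ← Real.exp_sub, ← Real.exp_sub, ← Real.exp_add]
  congr 1
  ring

/-- The step exponent on even levels is negative … [folklore] -/
theorem step_even (t : ℕ) : 2 * lev (2 * t + 1) - lev (2 * t) = -(Real.log 4 / 3) / 4 ^ t := by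
  rw [lev_odd, lev_even]; ring

/-- … and on odd levels positive. [folklore] -/
theorem step_odd (t : ℕ) : 2 * lev (2 * t + 1 + 1) - lev (2 * t + 1) = (Real.log 4 / 6) / 4 ^ t := by
  rw [show 2 * t + 1 + 1 = 2 * (t + 1) by ring, lev_even, lev_odd, pow_succ]
  field_simp
  ring

/-- At `k = 4ᵗ` the doubling ratio strictly INCREASES. [folklore] -/
theorem doubling_up (t : ℕ) :
    gW (2 * 4 ^ t) / gW (4 ^ t) < gW (2 * (4 ^ t + 1)) / gW (4 ^ t + 1) := by
  have hk : 1 ≤ 4 ^ t := Nat.one_le_pow _ _ (by norm_num)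
  have hlog : Nat.log 2 (4 ^ t) = 2 * t := by
    rw [show (4:ℕ) ^ t = 2 ^ (2 * t) by rw [pow_mul]; norm_num]
    exact Nat.log_pow (by norm_num) _
  rw [doubling_succ _ hk, hlog, step_even]
  have hpos : 0 < gW (2 * 4 ^ t) / gW (4 ^ t) := div_pos (gW_pos _) (gW_pos _)
  have hgt : 1 < Real.exp (-(-(Real.log 4 / 3) / 4 ^ t)) := by
    rw [Real.one_lt_exp_iff, neg_div, neg_neg]
    have := log_four_pos
    positivity
  exact lt_mul_of_one_lt_right hpos hgt

/-- At `k = 2·4ᵗ` the doubling ratio strictly DECREASES. [folklore] -/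
theorem doubling_down (t : ℕ) :
    gW (2 * (2 * 4 ^ t + 1)) / gW (2 * 4 ^ t + 1) < gW (2 * (2 * 4 ^ t)) / gW (2 * 4 ^ t) := by
  have hk : 1 ≤ 2 * 4 ^ t := by have := Nat.one_le_pow t 4 (by norm_num); omega
  have hlog : Nat.log 2 (2 * 4 ^ t) = 2 * t + 1 := by
    rw [show 2 * (4:ℕ) ^ t = 2 ^ (2 * t + 1) by rw [pow_succ, pow_mul]; norm_num; ring]
    exact Nat.log_pow (by norm_num) _
  rw [doubling_succ _ hk, hlog, step_odd]
  have hpos : 0 < gW (2 * (2 * 4 ^ t)) / gW (2 * 4 ^ t) := div_pos (gW_pos _) (gW_pos _)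
  have hlt : Real.exp (-(Real.log 4 / 6 / 4 ^ t)) < 1 := by
    rw [Real.exp_lt_one_iff]
    have := log_four_pos
    have : 0 < Real.log 4 / 6 / 4 ^ t := by positivity
    linarith
  exact mul_lt_of_lt_one_right hpos hlt

/-- **The witness' doubling ratio is not eventually monotone.** [folklore] -/
theorem not_eventuallyMonotoneDoubling_gW : ¬ EventuallyMonotoneDoubling gW := by
  rintro ⟨m₀, hmono | hanti⟩
  · have hk : m₀ ≤ 2 * 4 ^ m₀ := by have := le_four_pow m₀; omega
    have h := hmono (show 2 * 4 ^ m₀ ∈ Set.Ici m₀ from hk)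
      (show 2 * 4 ^ m₀ + 1 ∈ Set.Ici m₀ from le_trans hk (Nat.le_succ _)) (Nat.le_succ _)
    exact absurd (doubling_down m₀) (not_lt.2 h)
  · have hk : m₀ ≤ 4 ^ m₀ := le_four_pow m₀
    have h := hanti (show 4 ^ m₀ ∈ Set.Ici m₀ from hk)
      (show 4 ^ m₀ + 1 ∈ Set.Ici m₀ from le_trans hk (Nat.le_succ _)) (Nat.le_succ _)
    exact absurd (doubling_up m₀) (not_lt.2 h)

/-- **NEGATIVE LEMMA (abstract form).** The axis-facts package does NOT imply eventual monotonicity of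
the doubling ratio. [folklore] -/
theorem axisFacts_not_sufficient : ∃ g : ℕ → ℝ, AxisFacts g ∧ ¬ EventuallyMonotoneDoubling g :=
  ⟨gW, axisFacts_gW, not_eventuallyMonotoneDoubling_gW⟩

end Summit.CriticalPhenomena.Ising3DConformalLimit.Theorems.ZoomMonotone.Negative
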